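import Mathlib
import HarnessLib
import Summits.AtomisticToContinuum.BoseEinsteinCondensation.Theorems.DeepInfraredEmptinessPlaneWaveBudget
import Summits.AtomisticToContinuum.BoseEinsteinCondensation.Theorems.BlockLatticeFSumKinematics
import Literature.MathematicalPhysics.QuantumManyBody.PeriodicConfigFourier
import Literature.MathematicalPhysics.QuantumManyBody.PeriodicCondensateCoherence

/-!
# BlockLatticeFSum · residual `DeepInfraredEmptiness` (stmt-AtomisticToContinuum-27506) — piece AD is a THEOREM
# (decomp-a2c lens-6 «barrier-complement carving», generation 26; critic rows 371 (2)(5)(α) / 373 (2))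

**AliasDomination (AD).**  For every periodic trial state `Ψ` on the torus of side `L`, every block
number `K > 0` and every block wave `f_q(x) = L^{-3/2} exp(2πi q·⌊Kx/L⌋/K)` (`q ∈ (ℤ/K)³`):

  `⟨f_q, γ_Ψ f_q⟩ ≤ Σ_{m ∈ ℤ³} ⟨e_{q̃+Km}, γ_Ψ e_{q̃+Km}⟩`,

`q̃ⱼ = qⱼ` if `2qⱼ ≤ K` else `qⱼ − K` (centred representative), `e_p = planeWaveMode L p` the normalised
torus plane waves.  Proof (kinematics, no energy): slice-wise in the spectator variables `Y`,
`|∫_Ω conj(f_q) g|² ≤ Σ_m |∫_Ω conj(e_{q̃+Km}) g|²` for the continuous slice `g = Ψ(·, Y)`, by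

* POLARISED PARSEVAL on the cell (`UnitAddTorus.hasSum_prod_mFourierCoeff` transported along
  `torusFun / fromUnitTorus`, `integral_fromUnitTorus`): `∫_Ω conj(f) g = L³ Σ_p conj(ĉ_p f) ĉ_p g`;
* ALIAS SUPPORT BY COVARIANCE: `f_q` is `Lℤ³`-periodic and `f_q(x + (L/K)eⱼ) = e^{2πi qⱼ/K} f_q(x)`;
  translation invariance of the Haar integral on `(ℝ/ℤ)³` and the character property of the monomials
  give `ĉ_p(f_q) = e^{2πi(qⱼ−pⱼ)/K} ĉ_p(f_q)`, hence `ĉ_p(f_q) = 0` unless `p ≡ q (mod K)`, i.e. `p ∈ q̃ + Kℤ³`;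
* CAUCHY–SCHWARZ along the alias lattice with `Σ_p |ĉ_p(f_q)|² = L⁻³ ∫_{(ℝ/ℤ)³}… = L⁻³` (Parseval, `|f_q| ≡ L^{-3/2}`);

then `cellOccupation_succ` + `lintegral_tsum` (Tonelli) integrate the slice inequality.  THESES-FREE, def-free
(imports: the Theses-free `DeepInfraredEmptinessPlaneWaveBudget` for the centred-representative lattice lemmas and
`BlockLatticeFSumKinematics` for measurability of the verbatim block wave); conclusion of `aliasDomination_holds`
= the AD hypothesis text of `Theorems/DeepInfraredEmptinessPlaneWaveCarving.lean` VERBATIM, so that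
`deepInfraredEmptiness_of_irball_alias hIR aliasDomination_holds : BlockLatticeFSum.DeepInfraredEmptiness`.
For landing as `Theorems/DeepInfraredEmptinessAliasDomination.lean --supports stmt-AtomisticToContinuum-27506`.
-/

noncomputable section

namespace Summit.AtomisticToContinuum.BoseEinsteinCondensation.Theorems.DeepInfraredEmptinessAliasDomination

open MeasureTheory Complex Filter Set WithLp
open scoped ENNReal NNReal ComplexConjugate Topology
open Literature.MathematicalPhysics.QuantumManyBody.BoseGas
open Summit.AtomisticToContinuum.BoseEinsteinCondensation.Theorems.DeepInfraredEmptinessPlaneWaveBudget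
  (aliasMap_injective)
open Summit.AtomisticToContinuum.BoseEinsteinCondensation.Theses.BlockLatticeFSum.Kinematics
  (measurable_blockWave)

-- As in the landed torus files: the measure on `ℝ/ℤ` is the Haar probability measure (the named local
-- instances of `PeriodicConfigFourier.lean`, definitionally those of `PeriodicBoseGasFourier.lean`).
attribute [local instance] configFourier_measureSpace configFourier_isProbabilityMeasure
  configFourier_isProbabilityMeasure_pi configFourier_isAddLeftInvariant configFourier_isAddLeftInvariant_pi

/-! ## 1. Transport: additivity of `x ↦ x/L mod ℤ³`, characters, translation of periodic functions -/

-- `toUnitTorus_add` (`x ↦ x/L mod ℤ³` is additive) is `Literature…BoseGas.toUnitTorus_add`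
-- (`PeriodicCondensateCoherence.lean`, imported; the local copy was removed at landing, dedup).

/-- the monomials are characters: `e_n(x + y) = e_n(x) e_n(y)`. [folklore] -/
theorem mFourier_apply_add {d : Type*} [Fintype d] (n : d → ℤ) (x y : UnitAddTorus d) :
    UnitAddTorus.mFourier n (x + y) = UnitAddTorus.mFourier n x * UnitAddTorus.mFourier n y := by
  simp only [UnitAddTorus.mFourier, ContinuousMap.coe_mk, Pi.add_apply, fourier_apply, zsmul_add,
    AddCircle.toCircle_add, Circle.coe_mul, Finset.prod_mul_distrib]

/-- for an axis-periodic `φ`, translating on the torus translates the argument. [folklore] -/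
theorem torusFun_toUnitTorus_add {L : ℝ} (hL : 0 < L) {φ : Space → ℂ}
    (hφ : ∀ (x : Space) (k : Fin 3), φ (x + EuclideanSpace.single k L) = φ x)
    (y : Space) (t : UnitAddTorus (Fin 3)) :
    torusFun L φ (toUnitTorus L y + t) = φ (fromUnitTorus L t + y) := by
  calc torusFun L φ (toUnitTorus L y + t)
      = torusFun L φ (toUnitTorus L (y + fromUnitTorus L t)) := by
          rw [toUnitTorus_add, toUnitTorus_fromUnitTorus hL.ne']
    _ = φ (fromUnitTorus L t + y) := by rw [torusFun_toUnitTorus hL hφ, add_comm]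

/-- the character value at the block translation `(L/K) eⱼ`: `e_{-p}((L/K)eⱼ / L) = e^{-2πi pⱼ/K}`. [folklore] -/
theorem mFourier_neg_toUnitTorus_single {L : ℝ} (hL : 0 < L) {K : ℕ} (hK : 0 < K)
    (p : Fin 3 → ℤ) (j : Fin 3) :
    UnitAddTorus.mFourier (-p) (toUnitTorus L (EuclideanSpace.single j (L / K))) =
      Complex.exp (-(2 * Real.pi * Complex.I * (p j : ℂ) / (K : ℂ))) := by
  have hLc : (L : ℂ) ≠ 0 := by exact_mod_cast hL.ne'
  have hKc : ((K : ℝ) : ℂ) ≠ 0 := by exact_mod_cast hK.ne'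
  simp only [UnitAddTorus.mFourier, ContinuousMap.coe_mk, toUnitTorus, PiLp.single_apply]
  rw [Finset.prod_eq_single j]
  · simp only [if_true, Pi.neg_apply, fourier_coe_apply]
    congr 1
    push_cast
    field_simp
  · intro i _ hi
    simp only [if_neg hi, zero_div, Pi.neg_apply, fourier_coe_apply]
    simp
  · intro h
    exact absurd (Finset.mem_univ j) h

/-! ## 2. Fourier support by covariance -/

/-- **Alias support by covariance.** If `φ` is `Lℤ³`-periodic along the axes and covariant under the
translation by `a eⱼ`, `φ(x + a eⱼ) = ω φ(x)`, then `ĉ_p(φ) = 0` unless `e_{-p}(a eⱼ/L) ω = 1`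
(translation invariance of the Haar integral). [folklore] -/
theorem cellFourierCoeff_eq_zero_of_covariant {L : ℝ} (hL : 0 < L) {φ : Space → ℂ}
    (hφ : ∀ (x : Space) (k : Fin 3), φ (x + EuclideanSpace.single k L) = φ x)
    {j : Fin 3} {a : ℝ} {ω : ℂ} (hcov : ∀ x : Space, φ (x + EuclideanSpace.single j a) = ω * φ x)
    {p : Fin 3 → ℤ}
    (hne : UnitAddTorus.mFourier (-p) (toUnitTorus L (EuclideanSpace.single j a)) * ω ≠ 1) :
    cellFourierCoeff L φ p = 0 := by
  set s : UnitAddTorus (Fin 3) := toUnitTorus L (EuclideanSpace.single j a) with hs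
  set z : ℂ := UnitAddTorus.mFourier (-p) s * ω with hz
  set F : UnitAddTorus (Fin 3) → ℂ := fun t => UnitAddTorus.mFourier (-p) t • torusFun L φ t with hF
  have hshift : cellFourierCoeff L φ p = z * cellFourierCoeff L φ p := by
    have hinv : ∫ t, F t = ∫ t, F (s + t) :=
      (integral_add_left_eq_self (μ := (volume : Measure (UnitAddTorus (Fin 3)))) F s).symm
    have hpt : ∀ t, F (s + t) = z * F t := by
      intro t
      simp only [hF, smul_eq_mul]
      rw [mFourier_apply_add, hs, torusFun_toUnitTorus_add hL hφ, hcov]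
      simp only [torusFun, hz, hs]
      ring
    calc cellFourierCoeff L φ p = ∫ t, F t := rfl
      _ = ∫ t, F (s + t) := hinv
      _ = ∫ t, z * F t := integral_congr_ae (Eventually.of_forall hpt)
      _ = z * ∫ t, F t := integral_const_mul _ _
      _ = z * cellFourierCoeff L φ p := rfl
  have h1z : (1 - z) ≠ 0 := sub_ne_zero.2 (Ne.symm hne)
  have h0 : (1 - z) * cellFourierCoeff L φ p = 0 := by
    rw [sub_mul, one_mul, ← hshift, sub_self]
  exact (mul_eq_zero.1 h0).resolve_left h1z

/-! ## 3. Parseval on the cell for bounded measurable modes, polarised -/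

/-- the torus function of a bounded measurable function is in `L²`. [folklore] -/
theorem memLp_torusFun_of_bound (L : ℝ) {φ : Space → ℂ} (hφm : Measurable φ) {C : ℝ}
    (hC : ∀ x, ‖φ x‖ ≤ C) : MemLp (torusFun L φ) 2 (volume : Measure (UnitAddTorus (Fin 3))) :=
  MemLp.of_bound ((hφm.comp (measurable_fromUnitTorus L)).aestronglyMeasurable) C
    (Eventually.of_forall fun _ => hC _)

/-- **Parseval, polarised, on the cell**: `Σ_p conj(ĉ_p φ) ĉ_p g = L⁻³ ∫_{[0,L)³} conj(φ) g` for `φ, g` with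
`L²` torus functions. [folklore] -/
theorem hasSum_conj_cellFourierCoeff_mul {L : ℝ} (hL : 0 < L) {φ g : Space → ℂ}
    (hφ : MemLp (torusFun L φ) 2 (volume : Measure (UnitAddTorus (Fin 3))))
    (hg : MemLp (torusFun L g) 2 (volume : Measure (UnitAddTorus (Fin 3)))) :
    HasSum (fun p : Fin 3 → ℤ => conj (cellFourierCoeff L φ p) * cellFourierCoeff L g p)
      ((((L ^ 3)⁻¹ : ℝ) : ℂ) * ∫ x in cell L, conj (φ x) * g x) := by
  have hP := UnitAddTorus.hasSum_prod_mFourierCoeff (hφ.toLp _) (hg.toLp _)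
  have hcφ : ∀ n, UnitAddTorus.mFourierCoeff (hφ.toLp _ : UnitAddTorus (Fin 3) → ℂ) n =
      cellFourierCoeff L φ n := fun n =>
    integral_congr_ae (hφ.coeFn_toLp.mono fun t ht => by simp only [ht])
  have hcg : ∀ n, UnitAddTorus.mFourierCoeff (hg.toLp _ : UnitAddTorus (Fin 3) → ℂ) n =
      cellFourierCoeff L g n := fun n =>
    integral_congr_ae (hg.coeFn_toLp.mono fun t ht => by simp only [ht])
  have hint : (∫ t, conj ((hφ.toLp _ : UnitAddTorus (Fin 3) → ℂ) t) *
      (hg.toLp _ : UnitAddTorus (Fin 3) → ℂ) t) = ∫ t, conj (torusFun L φ t) * torusFun L g t :=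
    integral_congr_ae (by
      filter_upwards [hφ.coeFn_toLp, hg.coeFn_toLp] with t h1 h2
      rw [h1, h2])
  have htr : (∫ t, conj (torusFun L φ t) * torusFun L g t) =
      (((L ^ 3)⁻¹ : ℝ) : ℂ) * ∫ x in cell L, conj (φ x) * g x := by
    have h := integral_fromUnitTorus hL (fun x : Space => conj (φ x) * g x)
    rw [Complex.real_smul] at h
    exact h
  simp only [hcφ, hcg, hint, htr] at hP
  exact hP

/-- **Parseval on the cell** (norm form) for a bounded measurable mode of constant modulus `c`:
`Σ_p |ĉ_p φ|² = c²`. [folklore] -/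
theorem hasSum_sq_cellFourierCoeff_of_norm_eq (L : ℝ) {φ : Space → ℂ} (hφm : Measurable φ) {c : ℝ}
    (hc : ∀ x, ‖φ x‖ = c) :
    HasSum (fun p : Fin 3 → ℤ => ‖cellFourierCoeff L φ p‖ ^ 2) (c ^ 2) := by
  have hφ : MemLp (torusFun L φ) 2 (volume : Measure (UnitAddTorus (Fin 3))) :=
    memLp_torusFun_of_bound L hφm (fun x => (hc x).le)
  have hP := UnitAddTorus.hasSum_sq_mFourierCoeff (hφ.toLp _)
  have hcφ : ∀ n, UnitAddTorus.mFourierCoeff (hφ.toLp _ : UnitAddTorus (Fin 3) → ℂ) n =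
      cellFourierCoeff L φ n := fun n =>
    integral_congr_ae (hφ.coeFn_toLp.mono fun t ht => by simp only [ht])
  have hnorm : (∫ t, ‖(hφ.toLp _ : UnitAddTorus (Fin 3) → ℂ) t‖ ^ 2) = ∫ t, ‖torusFun L φ t‖ ^ 2 :=
    integral_congr_ae (hφ.coeFn_toLp.mono fun t ht => by simp only [ht])
  have hconst : (∫ t : UnitAddTorus (Fin 3), ‖torusFun L φ t‖ ^ 2) = c ^ 2 := by
    simp only [torusFun, hc, integral_const, smul_eq_mul, probReal_univ, one_mul]
  simp only [hcφ, hnorm, hconst] at hP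
  exact hP

/-! ## 4. Cauchy–Schwarz for a convergent series of products -/

/-- **Cauchy–Schwarz** for `s = Σ conj(uᵢ) vᵢ`: `|s|² ≤ (Σ|uᵢ|²)(Σ|vᵢ|²)`. [folklore] -/
theorem norm_sq_le_of_hasSum_conj_mul {ι : Type*} {u v : ι → ℂ} {s : ℂ}
    (hs : HasSum (fun i => conj (u i) * v i) s)
    (hu : Summable fun i => ‖u i‖ ^ 2) (hv : Summable fun i => ‖v i‖ ^ 2) :
    ‖s‖ ^ 2 ≤ (∑' i, ‖u i‖ ^ 2) * ∑' i, ‖v i‖ ^ 2 := by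
  have hbound : ∀ F : Finset ι,
      ‖∑ i ∈ F, conj (u i) * v i‖ ^ 2 ≤ (∑' i, ‖u i‖ ^ 2) * ∑' i, ‖v i‖ ^ 2 := by
    intro F
    have h1 : ‖∑ i ∈ F, conj (u i) * v i‖ ≤ ∑ i ∈ F, ‖u i‖ * ‖v i‖ := by
      refine (norm_sum_le _ _).trans (Finset.sum_le_sum fun i _ => ?_)
      rw [norm_mul, RCLike.norm_conj]
    have h2 : (∑ i ∈ F, ‖u i‖ * ‖v i‖) ^ 2 ≤ (∑ i ∈ F, ‖u i‖ ^ 2) * ∑ i ∈ F, ‖v i‖ ^ 2 :=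
      Finset.sum_mul_sq_le_sq_mul_sq F (fun i => ‖u i‖) (fun i => ‖v i‖)
    have h3 : (∑ i ∈ F, ‖u i‖ ^ 2) ≤ ∑' i, ‖u i‖ ^ 2 := hu.sum_le_tsum F (fun i _ => sq_nonneg _)
    have h4 : (∑ i ∈ F, ‖v i‖ ^ 2) ≤ ∑' i, ‖v i‖ ^ 2 := hv.sum_le_tsum F (fun i _ => sq_nonneg _)
    calc ‖∑ i ∈ F, conj (u i) * v i‖ ^ 2 ≤ (∑ i ∈ F, ‖u i‖ * ‖v i‖) ^ 2 :=
          pow_le_pow_left₀ (norm_nonneg _) h1 2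
      _ ≤ (∑ i ∈ F, ‖u i‖ ^ 2) * ∑ i ∈ F, ‖v i‖ ^ 2 := h2
      _ ≤ (∑' i, ‖u i‖ ^ 2) * ∑' i, ‖v i‖ ^ 2 :=
          mul_le_mul h3 h4 (Finset.sum_nonneg fun i _ => sq_nonneg _) (tsum_nonneg fun i => sq_nonneg _)
  have ht0 : Tendsto (fun F : Finset ι => ∑ i ∈ F, conj (u i) * v i) atTop (𝓝 s) := hs
  have ht : Tendsto (fun F : Finset ι => ‖∑ i ∈ F, conj (u i) * v i‖ ^ 2) atTop (𝓝 (‖s‖ ^ 2)) :=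
    (ht0.norm).pow 2
  exact le_of_tendsto' ht hbound

/-! ## 5. The slice inequality for a block-covariant mode -/

/-- **Slice inequality.** For a measurable mode `f` of constant modulus `L^{-3/2}` on `ℝ³`, `Lℤ³`-periodic along
the axes and covariant under the block translations `(L/K)eⱼ` with characters `e^{2πi qⱼ/K}`, and a continuous
slice `g`:  `|∫_Ω conj(f) g|² ≤ Σ_{m ∈ ℤ³} |∫_Ω conj(e_{q̃+Km}) g|²`. [folklore] -/
theorem sliceInner_sq_le_tsum_alias {L : ℝ} (hL : 0 < L) {K : ℕ} (hK : 0 < K) (q : Fin 3 → Fin K)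
    {f : Space → ℂ} (hfm : Measurable f) (hfn : ∀ x, ‖f x‖ = (Real.sqrt (L ^ 3))⁻¹)
    (hper : ∀ (x : Space) (k : Fin 3), f (x + EuclideanSpace.single k L) = f x)
    (hcov : ∀ (j : Fin 3) (x : Space), f (x + EuclideanSpace.single j (L / K)) =
      Complex.exp (((2 * Real.pi * ((q j : ℕ) : ℝ) / (K : ℝ) : ℝ) : ℂ) * Complex.I) * f x)
    {g : Space → ℂ} (hg : Continuous g) :
    ((‖∫ x in cell L, conj (f x) * g x‖₊ : ℝ≥0∞) ^ 2) ≤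
      ∑' m : Fin 3 → ℤ, ((‖∫ x in cell L, conj (planeWaveMode L
          (fun j => (if 2 * (q j : ℕ) ≤ K then (((q j : ℕ) : ℤ)) else (((q j : ℕ) : ℤ) - (K : ℤ))) + (K : ℤ) * m j) x)
            * g x‖₊ : ℝ≥0∞) ^ 2) := by
  have hL3 : (0 : ℝ) < L ^ 3 := by positivity
  have hKc : ((K : ℝ) : ℂ) ≠ 0 := by exact_mod_cast hK.ne'
  have h2pi : (2 * Real.pi * Complex.I : ℂ) ≠ 0 := by simp [Real.pi_ne_zero, Complex.I_ne_zero]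
  -- the alias lattice `m ↦ q̃ + Km`
  set e : (Fin 3 → ℤ) → (Fin 3 → ℤ) := fun m j =>
    (if 2 * (q j : ℕ) ≤ K then (((q j : ℕ) : ℤ)) else (((q j : ℕ) : ℤ) - (K : ℤ))) + (K : ℤ) * m j with he
  have he_inj : Function.Injective e := by
    intro m m' h
    have := aliasMap_injective K (a₁ := (q, m)) (a₂ := (q, m')) h
    exact (Prod.ext_iff.1 this).2
  -- alias support of the Fourier coefficients of `f`
  have hsupp : ∀ p : Fin 3 → ℤ, p ∉ Set.range e → cellFourierCoeff L f p = 0 := by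
    intro p hp
    -- some coordinate is off the residue class of `q`
    have hj : ∃ j : Fin 3, ¬ ((K : ℤ) ∣ (p j - ((q j : ℕ) : ℤ))) := by
      by_contra h
      push Not at h
      apply hp
      refine ⟨fun j => (p j - ((if 2 * (q j : ℕ) ≤ K then (((q j : ℕ) : ℤ)) else (((q j : ℕ) : ℤ) - (K : ℤ))))) / (K : ℤ), ?_⟩
      funext j
      have hdvd : (K : ℤ) ∣ (p j - (if 2 * (q j : ℕ) ≤ K then (((q j : ℕ) : ℤ)) else (((q j : ℕ) : ℤ) - (K : ℤ)))) := by
        split_ifs with h2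
        · exact h j
        · have : p j - ((((q j : ℕ) : ℤ)) - (K : ℤ)) = (p j - ((q j : ℕ) : ℤ)) + (K : ℤ) := by ring
          rw [this]
          exact dvd_add (h j) (dvd_refl _)
      simp only [he]
      rw [Int.mul_ediv_cancel' hdvd]
      ring
    obtain ⟨j, hj⟩ := hj
    refine cellFourierCoeff_eq_zero_of_covariant hL hper (hcov j) ?_
    rw [mFourier_neg_toUnitTorus_single hL hK p j, ← Complex.exp_add]
    intro hone
    obtain ⟨n, hn⟩ := Complex.exp_eq_one_iff.1 hone
    apply hj
    have h3 : (2 * Real.pi * Complex.I : ℂ) * (((((q j : ℕ) : ℤ) - p j : ℤ) : ℂ) / ((K : ℝ) : ℂ)) =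
        (2 * Real.pi * Complex.I : ℂ) * (n : ℂ) := by
      rw [mul_comm (2 * Real.pi * Complex.I : ℂ) (n : ℂ), ← hn]
      push_cast
      ring
    have h4 := mul_left_cancel₀ h2pi h3
    rw [div_eq_iff hKc] at h4
    have h5 : (((q j : ℕ) : ℤ) - p j : ℤ) = n * (K : ℤ) := by exact_mod_cast h4
    have h6 : (K : ℤ) ∣ (((q j : ℕ) : ℤ) - p j) := ⟨n, by rw [h5, mul_comm]⟩
    have h7 := h6.neg_right
    rwa [neg_sub] at h7
  -- `L²` data
  have hF : MemLp (torusFun L f) 2 (volume : Measure (UnitAddTorus (Fin 3))) :=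
    memLp_torusFun_of_bound L hfm (fun x => (hfn x).le)
  have hG : MemLp (torusFun L g) 2 (volume : Measure (UnitAddTorus (Fin 3))) := memLp_torusFun hL hg
  -- polarised Parseval, restricted to the alias lattice
  have hpol := hasSum_conj_cellFourierCoeff_mul hL hF hG
  have hpol' : HasSum (fun m => conj (cellFourierCoeff L f (e m)) * cellFourierCoeff L g (e m))
      ((((L ^ 3)⁻¹ : ℝ) : ℂ) * ∫ x in cell L, conj (f x) * g x) :=
    (he_inj.hasSum_iff (f := fun p => conj (cellFourierCoeff L f p) * cellFourierCoeff L g p)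
      (fun p hp => by simp only [hsupp p hp, map_zero, zero_mul])).2 hpol
  -- the norms of the coefficients of `f` along the alias lattice sum to `L⁻³`
  have hc2 : ((Real.sqrt (L ^ 3))⁻¹) ^ 2 = (L ^ 3)⁻¹ := by
    rw [inv_pow, Real.sq_sqrt hL3.le]
  have hnf : HasSum (fun p => ‖cellFourierCoeff L f p‖ ^ 2) ((L ^ 3)⁻¹) := by
    rw [← hc2]
    exact hasSum_sq_cellFourierCoeff_of_norm_eq L hfm hfn
  have hnf' : HasSum (fun m => ‖cellFourierCoeff L f (e m)‖ ^ 2) ((L ^ 3)⁻¹) :=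
    (he_inj.hasSum_iff (f := fun p => ‖cellFourierCoeff L f p‖ ^ 2)
      (fun p hp => by simp only [hsupp p hp, norm_zero, zero_pow two_ne_zero])).2 hnf
  have hng : Summable fun p => ‖cellFourierCoeff L g p‖ ^ 2 := (hasSum_sq_cellFourierCoeff hL hg).summable
  have hng' : Summable fun m => ‖cellFourierCoeff L g (e m)‖ ^ 2 := hng.comp_injective he_inj
  -- Cauchy–Schwarz
  have hCS := norm_sq_le_of_hasSum_conj_mul hpol' hnf'.summable hng'
  rw [hnf'.tsum_eq, norm_mul, mul_pow, Complex.norm_real, Real.norm_of_nonneg (inv_nonneg.2 hL3.le)] at hCS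
  set I : ℂ := ∫ x in cell L, conj (f x) * g x with hI
  set T : ℝ := ∑' m, ‖cellFourierCoeff L g (e m)‖ ^ 2 with hT
  have hT0 : 0 ≤ T := tsum_nonneg fun m => sq_nonneg _
  have key : ‖I‖ ^ 2 ≤ L ^ 3 * T := by
    have h := mul_le_mul_of_nonneg_left hCS (le_of_lt (pow_pos hL3 2))
    have e1 : (L ^ 3) ^ 2 * (((L ^ 3)⁻¹) ^ 2 * ‖I‖ ^ 2) = ‖I‖ ^ 2 := by field_simp
    have e2 : (L ^ 3) ^ 2 * ((L ^ 3)⁻¹ * T) = L ^ 3 * T := by field_simp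
    rw [e1, e2] at h
    exact h
  -- back to `ℝ≥0∞`
  have hrhs : (∑' m : Fin 3 → ℤ, ((‖∫ x in cell L, conj (planeWaveMode L (e m) x) * g x‖₊ : ℝ≥0∞) ^ 2)) =
      ENNReal.ofReal (L ^ 3 * T) := by
    simp only [nnnorm_sq_integral_conj_planeWaveMode_mul hL, coe_nnnorm_sq_eq_ofReal]
    rw [ENNReal.tsum_mul_left, ← ENNReal.ofReal_pow hL.le,
      ← ENNReal.ofReal_tsum_of_nonneg (fun m => sq_nonneg _) hng', ← ENNReal.ofReal_mul hL3.le]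
  rw [hrhs, coe_nnnorm_sq_eq_ofReal]
  exact ENNReal.ofReal_le_ofReal key

/-! ## 6. The block wave: modulus, periodicity, block covariance -/

/-- the block sum `Σ_j q_j ⌊K x_j/L⌋` under an axis shift `x ↦ x + a e_k` with `K a / L = c ∈ ℤ`. [folklore] -/
theorem blockSum_shift (L : ℝ) (K : ℕ) (q : Fin 3 → Fin K) (x : Space) (k : Fin 3) (a : ℝ) (c : ℤ)
    (hc : (K : ℝ) * a / L = c) :
    (∑ j : Fin 3, ((q j : ℕ) : ℝ) * (⌊(K : ℝ) * (x + EuclideanSpace.single k a) j / L⌋ : ℝ)) =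
      (∑ j : Fin 3, ((q j : ℕ) : ℝ) * (⌊(K : ℝ) * x j / L⌋ : ℝ)) + ((q k : ℕ) : ℝ) * (c : ℝ) := by
  have hfl : ∀ j : Fin 3, ⌊(K : ℝ) * (x + EuclideanSpace.single k a) j / L⌋ =
      ⌊(K : ℝ) * x j / L⌋ + if j = k then c else 0 := by
    intro j
    rw [PiLp.add_apply, PiLp.single_apply]
    split_ifs with h
    · rw [mul_add, add_div, hc, Int.floor_add_intCast]
    · rw [add_zero, add_zero]
  simp_rw [hfl, Int.cast_add, mul_add, Finset.sum_add_distrib]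
  congr 1
  simp [Finset.sum_ite_eq']

/-- the block wave under an axis shift `x ↦ x + a e_k` with `K a / L = c ∈ ℤ` picks up the character `e^{2πi q_k c/K}`.
[folklore] -/
theorem blockWave_shift {L : ℝ} {K : ℕ} (hK : 0 < K) (q : Fin 3 → Fin K) (x : Space) (k : Fin 3) (a : ℝ) (c : ℤ)
    (hc : (K : ℝ) * a / L = c) :
    (fun x : EuclideanSpace ℝ (Fin 3) => (((Real.sqrt (L ^ 3))⁻¹ : ℝ) : ℂ) * Complex.exp (((2 * Real.pi * (∑ j : Fin 3, ((q j : ℕ) : ℝ) * (⌊(K : ℝ) * x j / L⌋ : ℝ)) / (K : ℝ) : ℝ) : ℂ) * Complex.I)) (x + EuclideanSpace.single k a)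
      = Complex.exp (((2 * Real.pi * ((q k : ℕ) : ℝ) * (c : ℝ) / (K : ℝ) : ℝ) : ℂ) * Complex.I) *
        (fun x : EuclideanSpace ℝ (Fin 3) => (((Real.sqrt (L ^ 3))⁻¹ : ℝ) : ℂ) * Complex.exp (((2 * Real.pi * (∑ j : Fin 3, ((q j : ℕ) : ℝ) * (⌊(K : ℝ) * x j / L⌋ : ℝ)) / (K : ℝ) : ℝ) : ℂ) * Complex.I)) x := by
  have hKr : (K : ℝ) ≠ 0 := Nat.cast_ne_zero.2 hK.ne'
  dsimp only
  rw [blockSum_shift L K q x k a c hc]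
  have hsplit : (2 * Real.pi * ((∑ j : Fin 3, ((q j : ℕ) : ℝ) * (⌊(K : ℝ) * x j / L⌋ : ℝ)) + ((q k : ℕ) : ℝ) * (c : ℝ)) / (K : ℝ) : ℝ)
      = 2 * Real.pi * (∑ j : Fin 3, ((q j : ℕ) : ℝ) * (⌊(K : ℝ) * x j / L⌋ : ℝ)) / (K : ℝ)
        + 2 * Real.pi * ((q k : ℕ) : ℝ) * (c : ℝ) / (K : ℝ) := by ring
  rw [hsplit, Complex.ofReal_add, add_mul, Complex.exp_add]
  ring

/-! ## 7. AD holds -/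

/-- **AD holds (conclusion = the `AliasDomination` text of `Theorems/DeepInfraredEmptinessPlaneWaveCarving.lean`
verbatim):** `⟨f_q, γ_Ψ f_q⟩ ≤ Σ_{m ∈ ℤ³} ⟨e_{q̃+Km}, γ_Ψ e_{q̃+Km}⟩` for every periodic trial state and every
block wave. [folklore] -/
theorem aliasDomination_holds :
    ∀ (N : ℕ) (L : ℝ), 0 < L → ∀ K : ℕ, 0 < K → ∀ Ψ : PeriodicTrialState N L, ∀ q : Fin 3 → Fin K,
    cellOccupation N L (fun x : EuclideanSpace ℝ (Fin 3) => (((Real.sqrt (L ^ 3))⁻¹ : ℝ) : ℂ) * Complex.exp (((2 * Real.pi * (∑ j : Fin 3, ((q j : ℕ) : ℝ) * (⌊(K : ℝ) * x j / L⌋ : ℝ)) / (K : ℝ) : ℝ) : ℂ) * Complex.I)) Ψ.ψ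
      ≤ ∑' m : Fin 3 → ℤ, cellOccupation N L (planeWaveMode L
          (fun j => (if 2 * (q j : ℕ) ≤ K then (((q j : ℕ) : ℤ)) else (((q j : ℕ) : ℤ) - (K : ℤ))) + (K : ℤ) * m j)) Ψ.ψ := by
  intro N L hL K hK Ψ q
  cases N with
  | zero => simp [cellOccupation, occupation]
  | succ n =>
    have hKr : (K : ℝ) ≠ 0 := Nat.cast_ne_zero.2 hK.ne'
    have hΨ : Continuous Ψ.ψ := Ψ.contDiff.continuous
    have hslice : ∀ Y : Config n, Continuous fun x => Ψ.ψ (Matrix.vecCons x Y) := fun Y =>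
      hΨ.comp (continuous_id.matrixVecCons continuous_const)
    -- the hypotheses of the slice inequality for the block wave
    have hfn : ∀ x : Space, ‖(fun x : EuclideanSpace ℝ (Fin 3) => (((Real.sqrt (L ^ 3))⁻¹ : ℝ) : ℂ) * Complex.exp (((2 * Real.pi * (∑ j : Fin 3, ((q j : ℕ) : ℝ) * (⌊(K : ℝ) * x j / L⌋ : ℝ)) / (K : ℝ) : ℝ) : ℂ) * Complex.I)) x‖ = (Real.sqrt (L ^ 3))⁻¹ := by
      intro x
      dsimp only
      rw [norm_mul, Complex.norm_exp_ofReal_mul_I, mul_one, Complex.norm_real,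
        Real.norm_of_nonneg (inv_nonneg.2 (Real.sqrt_nonneg _))]
    have hper : ∀ (x : Space) (k : Fin 3), (fun x : EuclideanSpace ℝ (Fin 3) => (((Real.sqrt (L ^ 3))⁻¹ : ℝ) : ℂ) * Complex.exp (((2 * Real.pi * (∑ j : Fin 3, ((q j : ℕ) : ℝ) * (⌊(K : ℝ) * x j / L⌋ : ℝ)) / (K : ℝ) : ℝ) : ℂ) * Complex.I)) (x + EuclideanSpace.single k L) = (fun x : EuclideanSpace ℝ (Fin 3) => (((Real.sqrt (L ^ 3))⁻¹ : ℝ) : ℂ) * Complex.exp (((2 * Real.pi * (∑ j : Fin 3, ((q j : ℕ) : ℝ) * (⌊(K : ℝ) * x j / L⌋ : ℝ)) / (K : ℝ) : ℝ) : ℂ) * Complex.I)) x := by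
      intro x k
      have hc : (K : ℝ) * L / L = ((K : ℤ) : ℝ) := by
        rw [mul_div_assoc, div_self hL.ne', mul_one, Int.cast_natCast]
      rw [blockWave_shift hK q x k L (K : ℤ) hc]
      have h1 : Complex.exp (((2 * Real.pi * ((q k : ℕ) : ℝ) * (((K : ℤ) : ℤ) : ℝ) / (K : ℝ) : ℝ) : ℂ) * Complex.I) = 1 := by
        have : (((2 * Real.pi * ((q k : ℕ) : ℝ) * (((K : ℤ) : ℤ) : ℝ) / (K : ℝ) : ℝ) : ℂ) * Complex.I) =
            ((q k : ℕ) : ℂ) * (2 * Real.pi * Complex.I) := by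
          have hKc : (K : ℂ) ≠ 0 := Nat.cast_ne_zero.2 hK.ne'
          push_cast
          field_simp
        rw [this]
        exact Complex.exp_nat_mul_two_pi_mul_I _
      rw [h1, one_mul]
    have hcov : ∀ (j : Fin 3) (x : Space), (fun x : EuclideanSpace ℝ (Fin 3) => (((Real.sqrt (L ^ 3))⁻¹ : ℝ) : ℂ) * Complex.exp (((2 * Real.pi * (∑ j : Fin 3, ((q j : ℕ) : ℝ) * (⌊(K : ℝ) * x j / L⌋ : ℝ)) / (K : ℝ) : ℝ) : ℂ) * Complex.I)) (x + EuclideanSpace.single j (L / K)) = Complex.exp (((2 * Real.pi * ((q j : ℕ) : ℝ) / (K : ℝ) : ℝ) : ℂ) * Complex.I) * (fun x : EuclideanSpace ℝ (Fin 3) => (((Real.sqrt (L ^ 3))⁻¹ : ℝ) : ℂ) * Complex.exp (((2 * Real.pi * (∑ j : Fin 3, ((q j : ℕ) : ℝ) * (⌊(K : ℝ) * x j / L⌋ : ℝ)) / (K : ℝ) : ℝ) : ℂ) * Complex.I)) x := by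
      intro j x
      have hc : (K : ℝ) * (L / K) / L = ((1 : ℤ) : ℝ) := by
        rw [Int.cast_one]
        field_simp
      rw [blockWave_shift hK q x j (L / K) 1 hc, Int.cast_one, mul_one]
    simp only [cellOccupation_succ]
    rw [ENNReal.tsum_mul_left]
    refine mul_le_mul_right ?_ _
    rw [← lintegral_tsum fun m => (measurable_sliceInner (continuous_planeWaveMode L _) hΨ).aemeasurable]
    refine lintegral_mono fun Y => ?_
    exact sliceInner_sq_le_tsum_alias hL hK q (measurable_blockWave K L q) hfn hper hcov (hslice Y)

end Summit.AtomisticToContinuum.BoseEinsteinCondensation.Theorems.DeepInfraredEmptinessAliasDomination
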